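import Literature.NumberTheory.Sieve.LargeSieveCharacters
import HarnessLib

/-!
# Completion of sums: incomplete sums of a periodic function against its finite Fourier
# transform

Topic `Literature/NumberTheory/Sieve`, namespace `Literature.NumberTheory.Sieve.LargeSieve` (it
reuses the exponential `e`, the geometric sums and the harmonic majorant of
`LargeSieveCharacters.lean`, of which the Pólya–Vinogradov inequality `polyaVinogradov` is the
special case `Φ = χ`). Everything here is PROVED.

**The completion technique** (Bordellès, *Arithmetic Tales*, Thm 6.13 "Completion of Periodic
Functions": for `M < N ∈ ℤ`, `q ≥ 1` and `f : ℤ → ℂ` `q`-periodic,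
`|∑_{M < n ≤ N} f(n) − ((N−M)/q) ∑_{n=1}^{q} f(n)| ≤ max_{1 ≤ m < q} |∑_{n=1}^{q} f(n) e_q(mn)| · log q`;
Iwaniec–Kowalski §12.2): an incomplete sum of a `q`-periodic function over an interval is its
mean times the length, plus an error controlled by the non-zero finite Fourier coefficients and
a logarithm. We prove it in the form (constant `1 + log q` in place of `log q`)

* `norm_sum_Ioc_sub_le_of_dft_le` — for `q ≥ 2`, `Φ : ℤ/qℤ → ℂ`, `A, N ∈ ℕ` and
  `|𝓕Φ(k)| ≤ M` for all `k ≠ 0` (`𝓕Φ(k) = ∑_j e(−jk/q) Φ(j)`, Mathlib's `ZMod.dft`):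
  `‖∑_{A < n ≤ A+N} Φ(n) − (N/q) ∑_{j mod q} Φ(j)‖ ≤ M (1 + log q)`;
* `norm_sum_Ioc_le_of_dft_le` — if moreover `|∑_j Φ(j)| ≤ M₀` then
  `‖∑_{A < n ≤ A+N} Φ(n)‖ ≤ M₀ N/q + M (1 + log q)`,

from Fourier inversion on `ℤ/qℤ` (`eq_inv_mul_sum_dft`, Mathlib's `ZMod.dft_dft`; the zeroth
coefficient `𝓕Φ(0) = ∑_j Φ(j)` is Mathlib's `ZMod.dft_apply_zero`), the geometric
sums `|∑_{A<n≤A+N} e(bn/q)| ≤ 2/|e(b/q) − 1|` (`norm_sum_Ioc_e_le`) and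
`∑_{0<b<q} 1/|e(b/q) − 1| ≤ (q/2)(1 + log q)` (`inv_norm_e_sub_one_le`, `sum_Ioo_div_add_div_le`).
This is the "completion of sums (see [ik])" input of Tao–Teräväinen's Lemma 3.7
(`Literature.Barriers.Parity.TaoTeravainen2021_lemma37_k0`).

## References

* O. Bordellès, *Arithmetic Tales. Advanced Edition*, Universitext, Springer 2020, Thm 6.13
  (read on the page: held copy, p. 453).
* H. Iwaniec, E. Kowalski, *Analytic Number Theory*, AMS Coll. Publ. 53 (2004), §12.2
  ("Completing methods"); cited by Tao–Teräväinen, arXiv:2109.06291, §3.4, as "[ik]".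
-/

open Finset Real Complex

namespace Literature.NumberTheory.Sieve.LargeSieve

variable {q : ℕ} [NeZero q]

/-! ### Fourier inversion on `ℤ/qℤ` -/

/-- **Fourier inversion on `ℤ/qℤ`**: `Φ(n) = q⁻¹ ∑_{k mod q} e(kn/q) 𝓕Φ(k)` with Mathlib's
`𝓕Φ(k) = ∑_j e(−jk/q) Φ(j)` (`ZMod.dft`, `ZMod.dft_dft`). [folklore] -/
theorem eq_inv_mul_sum_dft (Φ : ZMod q → ℂ) (n : ZMod q) :
    Φ n = (q : ℂ)⁻¹ * ∑ k : ZMod q, ZMod.stdAddChar (k * n) * ZMod.dft Φ k := by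
  have h := congr_fun (ZMod.dft_dft Φ) (-n)
  rw [ZMod.dft_apply, neg_neg] at h
  simp only [mul_neg, neg_neg, smul_eq_mul] at h
  have hq : (q : ℂ) ≠ 0 := by exact_mod_cast NeZero.ne q
  rw [eq_inv_mul_iff_mul_eq₀ hq, ← h]

/-- `e(bn/q)` is the standard additive character of `ZMod q` at `bn`, for natural `n`.
[folklore] -/
theorem e_div_eq_stdAddChar_nat (b n : ℕ) :
    e ((b : ℝ) * (n : ℕ) / q) = ZMod.stdAddChar ((b : ZMod q) * (n : ZMod q)) := by
  have := e_div_eq_stdAddChar (q := q) b (n : ℤ)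
  simp only [Int.cast_natCast] at this
  exact this

/-! ### Completion of sums -/

/-- The incomplete sum as a combination of geometric sums:
`∑_{A<n≤A+N} Φ(n) = q⁻¹ ∑_{0 ≤ b < q} 𝓕Φ(b) ∑_{A<n≤A+N} e(bn/q)`. [folklore] -/
theorem sum_Ioc_eq_inv_mul_sum_dft_mul (Φ : ZMod q → ℂ) (A N : ℕ) :
    ∑ n ∈ Ioc A (A + N), Φ (n : ZMod q) =
      (q : ℂ)⁻¹ * ∑ b ∈ range q, ZMod.dft Φ (b : ZMod q) *
        ∑ n ∈ Ioc A (A + N), e ((b : ℝ) * (n : ℕ) / q) := by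
  calc ∑ n ∈ Ioc A (A + N), Φ (n : ZMod q)
      = ∑ n ∈ Ioc A (A + N), (q : ℂ)⁻¹ *
          ∑ k : ZMod q, ZMod.stdAddChar (k * (n : ZMod q)) * ZMod.dft Φ k :=
        sum_congr rfl fun n _ => eq_inv_mul_sum_dft Φ n
    _ = (q : ℂ)⁻¹ * ∑ n ∈ Ioc A (A + N),
          ∑ b ∈ range q, ZMod.dft Φ (b : ZMod q) * e ((b : ℝ) * (n : ℕ) / q) := by
        rw [mul_sum]
        refine sum_congr rfl fun n _ => ?_
        congr 1
        symm
        calc ∑ b ∈ range q, ZMod.dft Φ (b : ZMod q) * e ((b : ℝ) * (n : ℕ) / q)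
            = ∑ b ∈ range q, ZMod.dft Φ (b : ZMod q) *
                ZMod.stdAddChar ((b : ZMod q) * (n : ZMod q)) :=
              sum_congr rfl fun b _ => by rw [e_div_eq_stdAddChar_nat]
          _ = ∑ k : ZMod q, ZMod.dft Φ k * ZMod.stdAddChar (k * (n : ZMod q)) :=
              sum_range_eq_sum_zmod (fun k : ZMod q =>
                ZMod.dft Φ k * ZMod.stdAddChar (k * (n : ZMod q)))
          _ = _ := sum_congr rfl fun k _ => mul_comm _ _
    _ = _ := by
        congr 1
        rw [sum_comm]
        refine sum_congr rfl fun b _ => ?_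
        rw [mul_sum]

/-- **Completion of sums** (Bordellès Thm 6.13 / Iwaniec–Kowalski §12.2, with `1 + log q`): for
`q ≥ 2`, `Φ : ℤ/qℤ → ℂ` with `|𝓕Φ(k)| ≤ M` for all `k ≠ 0`, and any interval `(A, A+N]`,
`‖∑_{A<n≤A+N} Φ(n) − (N/q) ∑_{j mod q} Φ(j)‖ ≤ M (1 + log q)`.
[cite: Bordelles2020ArithmeticTales, Thm 6.13] -/
theorem norm_sum_Ioc_sub_le_of_dft_le (hq : 2 ≤ q) (Φ : ZMod q → ℂ) {M : ℝ}
    (hM : ∀ k : ZMod q, k ≠ 0 → ‖ZMod.dft Φ k‖ ≤ M) (A N : ℕ) :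
    ‖∑ n ∈ Ioc A (A + N), Φ (n : ZMod q) - (N : ℂ) / q * ∑ j : ZMod q, Φ j‖ ≤
      M * (1 + Real.log q) := by
  have hq0 : (0 : ℝ) < q := by exact_mod_cast (by omega : 0 < q)
  have hqC : (q : ℂ) ≠ 0 := by exact_mod_cast (by omega : q ≠ 0)
  have hM0 : 0 ≤ M := by
    haveI : Fact (1 < q) := ⟨hq⟩
    exact (norm_nonneg _).trans (hM 1 one_ne_zero)
  -- split off `b = 0`
  have hr : range q = insert 0 (Ioo 0 q) := by
    ext b; simp only [mem_range, mem_insert, mem_Ioo]; omega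
  have h0 : ZMod.dft Φ ((0 : ℕ) : ZMod q) * ∑ n ∈ Ioc A (A + N), e (((0 : ℕ) : ℝ) * (n : ℕ) / q) =
      (N : ℂ) * ∑ j : ZMod q, Φ j := by
    rw [Nat.cast_zero, ZMod.dft_apply_zero]
    have : ∀ n : ℕ, e (((0 : ℕ) : ℝ) * (n : ℕ) / q) = 1 := fun n => by
      rw [Nat.cast_zero, zero_mul, zero_div, e_zero]
    simp only [this, sum_const, Nat.card_Ioc, nsmul_eq_mul, mul_one, add_tsub_cancel_left]
    rw [mul_comm]
  have hsplit : ∑ n ∈ Ioc A (A + N), Φ (n : ZMod q) - (N : ℂ) / q * ∑ j : ZMod q, Φ j =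
      (q : ℂ)⁻¹ * ∑ b ∈ Ioo 0 q, ZMod.dft Φ (b : ZMod q) *
        ∑ n ∈ Ioc A (A + N), e ((b : ℝ) * (n : ℕ) / q) := by
    rw [sum_Ioc_eq_inv_mul_sum_dft_mul, hr, sum_insert (by simp), h0, mul_add]
    field_simp
    ring
  -- the terms `0 < b < q` are geometric sums
  have hterm : ∀ b ∈ Ioo 0 q,
      ‖ZMod.dft Φ (b : ZMod q) * ∑ n ∈ Ioc A (A + N), e ((b : ℝ) * (n : ℕ) / q)‖ ≤
        M * (2 * ((q : ℝ) / (4 * b) + (q : ℝ) / (4 * (q - b : ℕ)))) := by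
    intro b hb
    rw [mem_Ioo] at hb
    obtain ⟨hb0, hbq⟩ := hb
    have hne : e ((b : ℝ) / q) ≠ 1 := by
      intro h
      have h1 : ‖e ((b : ℝ) / q) - 1‖ = 0 := by rw [h, sub_self, norm_zero]
      rw [norm_e_sub_one] at h1
      have hpos : 0 < Real.sin (π * ((b : ℝ) / q)) := by
        refine Real.sin_pos_of_pos_of_lt_pi (by positivity) ?_
        calc π * ((b : ℝ) / q) < π * 1 := by
              gcongr; rw [div_lt_one hq0]; exact_mod_cast hbq
          _ = π := mul_one π
      have : |Real.sin (π * ((b : ℝ) / q))| = 0 := by linarith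
      rw [abs_eq_zero] at this
      linarith
    have hgeom : ‖∑ n ∈ Ioc A (A + N), e ((b : ℝ) * (n : ℕ) / q)‖ ≤ 2 / ‖e ((b : ℝ) / q) - 1‖ := by
      have := norm_sum_Ioc_e_le A N hne
      refine le_of_eq_of_le (congr_arg _ (sum_congr rfl fun n _ => ?_)) this
      congr 1; ring
    have hbne : (b : ZMod q) ≠ 0 := by
      intro h
      rw [ZMod.natCast_eq_zero_iff] at h
      exact absurd (Nat.le_of_dvd hb0 h) (not_le.mpr hbq)
    rw [norm_mul]
    calc ‖ZMod.dft Φ (b : ZMod q)‖ * ‖∑ n ∈ Ioc A (A + N), e ((b : ℝ) * (n : ℕ) / q)‖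
        ≤ M * (2 / ‖e ((b : ℝ) / q) - 1‖) :=
          mul_le_mul (hM _ hbne) hgeom (norm_nonneg _) hM0
      _ = M * (2 * ‖e ((b : ℝ) / q) - 1‖⁻¹) := by rw [div_eq_mul_inv]
      _ ≤ M * (2 * ((q : ℝ) / (4 * b) + (q : ℝ) / (4 * (q - b : ℕ)))) :=
          mul_le_mul_of_nonneg_left
            (mul_le_mul_of_nonneg_left (inv_norm_e_sub_one_le hb0 hbq) zero_le_two) hM0
  -- assemble
  have hsum : ‖∑ b ∈ Ioo 0 q, ZMod.dft Φ (b : ZMod q) *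
      ∑ n ∈ Ioc A (A + N), e ((b : ℝ) * (n : ℕ) / q)‖ ≤ M * (q * (1 + Real.log q)) := by
    refine (norm_sum_le _ _).trans ((sum_le_sum hterm).trans ?_)
    rw [← mul_sum, ← mul_sum]
    have := sum_Ioo_div_add_div_le q
    nlinarith [this, hq0, hM0]
  rw [hsplit, norm_mul, norm_inv, Complex.norm_natCast]
  calc (q : ℝ)⁻¹ * ‖∑ b ∈ Ioo 0 q, ZMod.dft Φ (b : ZMod q) *
          ∑ n ∈ Ioc A (A + N), e ((b : ℝ) * (n : ℕ) / q)‖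
      ≤ (q : ℝ)⁻¹ * (M * (q * (1 + Real.log q))) :=
        mul_le_mul_of_nonneg_left hsum (by positivity)
    _ = M * (1 + Real.log q) := by field_simp

/-- **Completion of sums, bound form**: for `q ≥ 2`, `Φ : ℤ/qℤ → ℂ` with `|∑_j Φ(j)| ≤ M₀` and
`|𝓕Φ(k)| ≤ M` for `k ≠ 0`: `‖∑_{A<n≤A+N} Φ(n)‖ ≤ M₀ N/q + M (1 + log q)` — "by subdividing
longer intervals … `(|I|/q + 1)`". [cite: Bordelles2020ArithmeticTales, Thm 6.13] -/
theorem norm_sum_Ioc_le_of_dft_le (hq : 2 ≤ q) (Φ : ZMod q → ℂ) {M₀ M : ℝ}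
    (hM₀ : ‖∑ j : ZMod q, Φ j‖ ≤ M₀) (hM : ∀ k : ZMod q, k ≠ 0 → ‖ZMod.dft Φ k‖ ≤ M)
    (A N : ℕ) :
    ‖∑ n ∈ Ioc A (A + N), Φ (n : ZMod q)‖ ≤ M₀ * (N / q) + M * (1 + Real.log q) := by
  have hq0 : (0 : ℝ) < q := by exact_mod_cast (by omega : 0 < q)
  have h1 := norm_sum_Ioc_sub_le_of_dft_le hq Φ hM A N
  have h2 : ‖(N : ℂ) / q * ∑ j : ZMod q, Φ j‖ ≤ M₀ * (N / q) := by
    rw [norm_mul, norm_div, Complex.norm_natCast, Complex.norm_natCast, mul_comm]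
    exact mul_le_mul_of_nonneg_right hM₀ (by positivity)
  calc ‖∑ n ∈ Ioc A (A + N), Φ (n : ZMod q)‖
      = ‖(∑ n ∈ Ioc A (A + N), Φ (n : ZMod q) - (N : ℂ) / q * ∑ j : ZMod q, Φ j) +
          (N : ℂ) / q * ∑ j : ZMod q, Φ j‖ := by rw [sub_add_cancel]
    _ ≤ ‖∑ n ∈ Ioc A (A + N), Φ (n : ZMod q) - (N : ℂ) / q * ∑ j : ZMod q, Φ j‖ +
          ‖(N : ℂ) / q * ∑ j : ZMod q, Φ j‖ := norm_add_le _ _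
    _ ≤ M * (1 + Real.log q) + M₀ * (N / q) := add_le_add h1 h2
    _ = M₀ * (N / q) + M * (1 + Real.log q) := by ring

end Literature.NumberTheory.Sieve.LargeSieve
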